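import Summits.Ventures.CertifiedManyBodySolver.Upper.IntervalReaderTransfer
import Summits.Ventures.CertifiedManyBodySolver.Upper.UMPSDualBound
import Literature.MathematicalPhysics.QuantumLattice.OverlapKernelTools

/-!
# Ventures/CertifiedManyBodySolver — Upper/IntervalReaderBridge.lean: the interval reader's transfer operator in the uMPS vocabulary

HONEST FRAMING: first certified bounds; not a superconductivity verdict; every number certified or labelled
float.  Pure algebra; no claim about the Hubbard model.

The Theorem-H1′ files (`IntervalReaderSchur` / `IntervalReaderTransfer` / `IntervalReaderH1`) speak of
`IntervalReader.transferOp A O Y = Σ_{s,s′} O s s′ • (A s)ᴴ · Y · A s′` for rectangular slices over `RCLike 𝕜` and an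
arbitrary finite automaton index.  The uMPS certificate files (`UMPSDualBound`, `BellmanComposition`, `UMPSEnergyBound`)
speak of `heisenberg A B = Σ_s (A s)ᴴ B (A s)` and `bondImage A X` for a square `MPSTensor q D` over `ℂ`.  This file
records that the second vocabulary is the first at `O = 1` (one site) and at `O = X`, `Y = 1` with two-site slices
(`transferOp_one_eq_heisenberg`, `transferOp_pair_eq_bondImage`), so the transfer bound (L1) and the norm-layer bound
apply verbatim to the uMPS objects (`l2_opNorm_heisenberg_le`, `l2_opNorm_bondImage_le`; the identity-norm step reuses
`Literature…QuantumLattice.l2_opNorm_one_le` of `OverlapKernelTools`): with a Gram constant `κ` of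
the slices (`Σ_s ‖A s z‖² ≤ κ‖z‖²`, e.g. `κ = 1` for a left-isometric tensor, `gram A = 1`) one has
`‖heisenberg A Y‖₂ ≤ κ‖Y‖₂` and `‖bondImage A X‖₂ ≤ √(R·C) · κ₂` where `κ₂` is a Gram constant of the two-site slices
`p ↦ A p.1 * A p.2` and `R, C` bound the absolute row / column sums of `X`.
-/

noncomputable section

open Matrix Finset WithLp
open scoped BigOperators ComplexOrder Matrix.Norms.L2Operator

namespace Summit.Ventures.CertifiedManyBodySolver.Upper.IntervalReader

open Literature.MathematicalPhysics.QuantumLattice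

variable {q D : ℕ}

/-- At the identity site operator the interval reader's transfer operator IS the uMPS Heisenberg map. -/
theorem transferOp_one_eq_heisenberg (A : MPSTensor q D) (Y : Matrix (Fin D) (Fin D) ℂ) :
    transferOp A (1 : Matrix (Fin q) (Fin q) ℂ) Y = heisenberg A Y := by
  rw [transferOp_one]; rfl

/-- With two-site slices `p ↦ A p.1 * A p.2`, site operator `X` and environment `1`, the interval reader's transfer
operator IS the uMPS bond image `bondImage A X` (METHOD-umps «the bond operator pushed onto the bond space»). -/
theorem transferOp_pair_eq_bondImage (A : MPSTensor q D) (X : Matrix (Fin q × Fin q) (Fin q × Fin q) ℂ) :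
    transferOp (fun p : Fin q × Fin q => A p.1 * A p.2) X (1 : Matrix (Fin D) (Fin D) ℂ) = bondImage A X := by
  unfold transferOp bondImage
  refine Finset.sum_congr rfl fun p _ => Finset.sum_congr rfl fun p' _ => ?_
  rw [Matrix.mul_one]

/-- **Norm-layer bound in the uMPS vocabulary.**  `‖heisenberg A Y‖₂ ≤ κ‖Y‖₂` for any Gram constant `κ` of the slices
(in particular `κ = ‖gram A‖₂`, and `κ = 1` for a left-isometric tensor). -/
theorem l2_opNorm_heisenberg_le (A : MPSTensor q D) {κ : ℝ} (hκ0 : 0 ≤ κ)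
    (hκ : ∀ z : EuclideanSpace ℂ (Fin D), ∑ s, ‖toLp 2 (A s *ᵥ ofLp z)‖ ^ 2 ≤ κ * ‖z‖ ^ 2)
    (Y : Matrix (Fin D) (Fin D) ℂ) : ‖heisenberg A Y‖ ≤ κ * ‖Y‖ := by
  rw [← transferOp_one_eq_heisenberg, transferOp_one]
  exact l2_opNorm_heisenbergSum_le A hκ0 hκ Y

/-- **(L1) in the uMPS vocabulary.**  `‖bondImage A X‖₂ ≤ √(R·C) · κ₂` with `κ₂` a Gram constant of the two-site slices
`p ↦ A p.1 * A p.2` and `R, C` bounds of the absolute row / column sums of `X`. -/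
theorem l2_opNorm_bondImage_le (A : MPSTensor q D) {κ₂ : ℝ} (hκ0 : 0 ≤ κ₂)
    (hκ : ∀ z : EuclideanSpace ℂ (Fin D), ∑ p : Fin q × Fin q, ‖toLp 2 ((A p.1 * A p.2) *ᵥ ofLp z)‖ ^ 2 ≤ κ₂ * ‖z‖ ^ 2)
    (X : Matrix (Fin q × Fin q) (Fin q × Fin q) ℂ) {R C : ℝ} (hR0 : 0 ≤ R) (hC0 : 0 ≤ C)
    (hrow : ∀ p, ∑ p', ‖X p p'‖ ≤ R) (hcol : ∀ p', ∑ p, ‖X p p'‖ ≤ C) :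
    ‖bondImage A X‖ ≤ Real.sqrt (R * C) * κ₂ := by
  rw [← transferOp_pair_eq_bondImage]
  have h := l2_opNorm_transferOp_le (fun p : Fin q × Fin q => A p.1 * A p.2) hκ0 hκ X hR0 hC0 hrow hcol 1
  refine h.trans ?_
  have h0 : 0 ≤ Real.sqrt (R * C) * κ₂ := by positivity
  calc Real.sqrt (R * C) * κ₂ * ‖(1 : Matrix (Fin D) (Fin D) ℂ)‖
      ≤ Real.sqrt (R * C) * κ₂ * 1 :=
        mul_le_mul_of_nonneg_left Literature.MathematicalPhysics.QuantumLattice.l2_opNorm_one_le h0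
    _ = Real.sqrt (R * C) * κ₂ := mul_one _

end Summit.Ventures.CertifiedManyBodySolver.Upper.IntervalReader

end
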